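import Summits.CriticalPhenomena.PercolationContinuityZ3.Theorems.PercNearOneGluingNoHeavyLowerTailFaceCertKernel
import Mathlib.Data.Real.Basic
import HarnessLib

/-!
# `NoHeavyLowerTail` (crux stmt-CriticalPhenomena-4575), master-family line P2: kernel replay of the sunflower DOMINATION identities —
# substitution of the mass relation into reflected polynomials

Support file (seat `prim-masterthm-p2`, gen 3; `--supports stmt-CriticalPhenomena-4575`); no named fact, no sorry.  A small extension of
prim-cert-2's reflection engine `…FaceCertKernel` (`PPoly`, `toPP`, `subCheckP`, `coeffsP`, `ctx15`): the domination identities of the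
sunflower posets (`∏(i+a)·E_n(F) = E_m(row) + P`, memo SAHI-ROUTE §4.12(d)) hold MODULO the mass relation `a = 1 − b − Σ_j c_j`; to check
them as exact polynomial identities in the kernel we substitute the reflected expression `1 − (x₁ + … + x₆)` for the variable `x₀` inside
the reflected identity (`subst0`, kernel-computable by raw recursors) and relate its value to the original through the context
(`denote_subst0`: the value of `subst0 s e` at `ctx15 x₀ …` is the value of `e` at the context whose slot `0` holds the value of `s`).
-/

namespace Summit.CriticalPhenomena.PercolationContinuityZ3.Theorems.SahiDeltaSystem

namespace SunCert

open Lean.Grind.CommRing (Expr Context)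

open FaceCertKernel

/-- Substitute the expression `s` for the variable `x₀` in `e` (raw recursors, for kernel evaluation). [this work] -/
noncomputable def subst0 (s : Expr) (e : Expr) : Expr :=
  Expr.rec (motive := fun _ => Expr)
    (fun k => .num k) (fun n => .natCast n) (fun k => .intCast k)
    (fun i => Bool.rec (motive := fun _ => Expr) (.var i) s (Nat.beq i 0))
    (fun _ ih => .neg ih) (fun _ _ ih₁ ih₂ => .add ih₁ ih₂) (fun _ _ ih₁ ih₂ => .sub ih₁ ih₂)
    (fun _ _ ih₁ ih₂ => .mul ih₁ ih₂) (fun _ k ih => .pow ih k) e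

section Semantics

variable {R : Type*} [CommRing R]

omit [CommRing R] in
/-- Slots other than `0` of `ctx15` do not see the first argument. [folklore] -/
theorem ctx15_get_of_ne_zero (y x₁ x₂ x₃ x₄ x₅ x₆ x₇ x₈ x₉ x₁₀ x₁₁ x₁₂ x₁₃ x₁₄ x₁₅ : R) {i : ℕ} (hi : i ≠ 0) :
    (ctx15 y x₂ x₃ x₄ x₅ x₆ x₇ x₈ x₉ x₁₀ x₁₁ x₁₂ x₁₃ x₁₄ x₁₅).get i = (ctx15 x₁ x₂ x₃ x₄ x₅ x₆ x₇ x₈ x₉ x₁₀ x₁₁ x₁₂ x₁₃ x₁₄ x₁₅).get i := by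
  simp only [Lean.RArray.get_eq_getImpl, ctx15, Lean.RArray.getImpl]
  split_ifs <;> first | rfl | omega

omit [CommRing R] in
/-- Slot `0` of `ctx15` is the first argument. [folklore] -/
theorem ctx15_get_zero (x₁ x₂ x₃ x₄ x₅ x₆ x₇ x₈ x₉ x₁₀ x₁₁ x₁₂ x₁₃ x₁₄ x₁₅ : R) :
    (ctx15 x₁ x₂ x₃ x₄ x₅ x₆ x₇ x₈ x₉ x₁₀ x₁₁ x₁₂ x₁₃ x₁₄ x₁₅).get 0 = x₁ := rfl

/-- **Semantics of the substitution**: the value of `subst0 s e` at `ctx15 x₁ … x₁₅` is the value of `e` at the same context with slot `0`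
replaced by the value of `s`. [this work] -/
theorem denote_subst0 (s e : Expr) (x₁ x₂ x₃ x₄ x₅ x₆ x₇ x₈ x₉ x₁₀ x₁₁ x₁₂ x₁₃ x₁₄ x₁₅ : R) :
    (subst0 s e).denote (ctx15 x₁ x₂ x₃ x₄ x₅ x₆ x₇ x₈ x₉ x₁₀ x₁₁ x₁₂ x₁₃ x₁₄ x₁₅) =
      e.denote (ctx15 (s.denote (ctx15 x₁ x₂ x₃ x₄ x₅ x₆ x₇ x₈ x₉ x₁₀ x₁₁ x₁₂ x₁₃ x₁₄ x₁₅)) x₂ x₃ x₄ x₅ x₆ x₇ x₈ x₉ x₁₀ x₁₁ x₁₂ x₁₃ x₁₄ x₁₅) := by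
  induction e with
  | num k => rfl
  | natCast n => rfl
  | intCast k => rfl
  | var i =>
    by_cases hi : i = 0
    · subst hi; rfl
    · have hb : Nat.beq i 0 = false := by
        cases h : Nat.beq i 0
        · rfl
        · exact absurd (Nat.eq_of_beq_eq_true h) hi
      show Expr.denote _ (Bool.rec (motive := fun _ => Expr) (.var i) s (Nat.beq i 0)) = _
      rw [hb]
      show (ctx15 x₁ x₂ x₃ x₄ x₅ x₆ x₇ x₈ x₉ x₁₀ x₁₁ x₁₂ x₁₃ x₁₄ x₁₅).get i = (ctx15 _ x₂ x₃ x₄ x₅ x₆ x₇ x₈ x₉ x₁₀ x₁₁ x₁₂ x₁₃ x₁₄ x₁₅).get i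
      exact (ctx15_get_of_ne_zero _ _ x₂ x₃ x₄ x₅ x₆ x₇ x₈ x₉ x₁₀ x₁₁ x₁₂ x₁₃ x₁₄ x₁₅ hi).symm
  | neg a ih => show -(Expr.denote _ (subst0 s a)) = -(Expr.denote _ a); rw [ih]
  | add a b iha ihb => show Expr.denote _ (subst0 s a) + Expr.denote _ (subst0 s b) = Expr.denote _ a + Expr.denote _ b; rw [iha, ihb]
  | sub a b iha ihb => show Expr.denote _ (subst0 s a) - Expr.denote _ (subst0 s b) = Expr.denote _ a - Expr.denote _ b; rw [iha, ihb]
  | mul a b iha ihb => show Expr.denote _ (subst0 s a) * Expr.denote _ (subst0 s b) = Expr.denote _ a * Expr.denote _ b; rw [iha, ihb]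
  | pow a k ih => show Expr.denote _ (subst0 s a) ^ k = Expr.denote _ a ^ k; rw [ih]

/-- Unfolding `denote` of a product. [folklore] -/
theorem denote_mul (ctx : Context R) (e₁ e₂ : Expr) : (Expr.mul e₁ e₂).denote ctx = e₁.denote ctx * e₂.denote ctx := rfl

/-- Unfolding `denote` of a sum. [folklore] -/
theorem denote_add (ctx : Context R) (e₁ e₂ : Expr) : (Expr.add e₁ e₂).denote ctx = e₁.denote ctx + e₂.denote ctx := rfl

end Semantics

/-! ### Compact certificate data: monomials by exponent vectors -/

/-- Sum of a (nonempty) list of reflected expressions, `x₁ + (x₂ + (… + x_k))` (raw recursors; `[] ↦ 0`). [this work] -/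
noncomputable def SUM (l : List Expr) : Expr :=
  List.rec (motive := fun _ => Expr) (.num 0)
    (fun x xs ih => List.rec (motive := fun _ => Expr) x (fun _ _ _ => Expr.add x ih) xs) l

/-- Monomial `c · x₀^e₀ ⋯ x₅^e₅` as a reflected expression (six cells: `Sun 4`). [this work] -/
noncomputable def M6 (c : Int) (e0 e1 e2 e3 e4 e5 : Nat) : Expr :=
  .mul (.num c) (.mul (.pow (.var 0) e0) (.mul (.pow (.var 1) e1) (.mul (.pow (.var 2) e2) (.mul (.pow (.var 3) e3)
    (.mul (.pow (.var 4) e4) (.pow (.var 5) e5))))))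

/-- Monomial `c · x₀^e₀ ⋯ x₆^e₆` as a reflected expression (seven cells: `Sun 5`). [this work] -/
noncomputable def M7 (c : Int) (e0 e1 e2 e3 e4 e5 e6 : Nat) : Expr :=
  .mul (.num c) (.mul (.pow (.var 0) e0) (.mul (.pow (.var 1) e1) (.mul (.pow (.var 2) e2) (.mul (.pow (.var 3) e3)
    (.mul (.pow (.var 4) e4) (.mul (.pow (.var 5) e5) (.pow (.var 6) e6)))))))

section Test

/-- Tiny test: `x₀·x₁` with `x₀ := 1 − x₁` equals `x₁ − x₁²` (kernel check + substitution semantics). [this work] -/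
theorem test_subst (u v : ℝ) (huv : u = 1 - v) : u * v = v - v ^ 2 := by
  have hchk : subCheckP (toPP (subst0 (.sub (.num 1) (.var 1)) (.mul (.var 0) (.var 1))))
      (toPP (.sub (.var 1) (.pow (.var 1) 2))) = true := by decide +kernel
  have hid := denote_eq_of_subCheckP (ctx15 u v 0 0 0 0 0 0 0 0 0 0 0 0 (0:ℝ)) _ _ hchk
  rw [denote_toPP _ _ (by decide +kernel), denote_toPP _ _ (by decide +kernel), denote_subst0] at hid
  have hA : Expr.denote (ctx15 u v 0 0 0 0 0 0 0 0 0 0 0 0 (0:ℝ)) (.sub (.num 1) (.var 1)) = u := by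
    show (1:ℝ) - v = u; rw [huv]
  rw [hA] at hid
  exact hid

end Test

end SunCert

end Summit.CriticalPhenomena.PercolationContinuityZ3.Theorems.SahiDeltaSystem
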